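import Literature.NumberTheory.LFunctions.StarkExceptionalZeroProofs
import Literature.NumberTheory.LFunctions.UniformClassGroupPNTGeneralDegree
import HarnessLib

/-!
# Stark's lemma: at most one zero of `ζ_M` near `s = 1` — proof of
# `Stark1974_dedekindZeta_atMostOneZero` (Murty–Murty 1997, Ch. 2, Prop. 6.1; Stark 1974, Lemma 3)

Topic `Literature/NumberTheory/LFunctions`; sibling of `UniformClassGroupPNTGeneralDegree.lean`, whose
named fact `Literature.NumberTheory.LFunctions.NumberField.Stark1974_dedekindZeta_atMostOneZero`
("if `M ≠ ℚ`, `ζ_M` has at most one zero in the region `σ ≥ 1 − 1/(4 log|d_M|)`,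
`|t| ≤ 1/(4 log|d_M|)`", and such a zero is real and simple; typed with the continuation
`dedekindZetaCont M`, the pole `s = 1` excluded, simplicity as `deriv ζ_M ≠ 0`) is DISCHARGED
here (`Stark1974_dedekindZeta_atMostOneZero_holds`). Everything in this file is PROVED (theorems
only; no definition, no named fact).

The mathematics — the printed proof of Murty–Murty, Prop. 6.1: the entire function
`f(s) = s(s−1)Λ_M(s)`, the logarithmic derivative of its Hadamard product,
`1/(σ−ρ) + 1/(σ−ρ̄) > 0`, negativity of the archimedean terms for `1 < σ < 2`, and the numerics at
`σ = 1 + 1/log|d_M|` — is the tree's PROVED theorem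
`Literature.NumberTheory.LFunctions.NumberField.Stark1974_atMostOneZero_holds`
(`StarkExceptionalZeroProofs.lean`, built on the positivity device
`Literature.NumberTheory.LFunctions.Stark1974.re_logDeriv_nonneg_of_symmetric` of
`StarkHadamardPositivity.lean` — Hadamard's genus-zero theorem `hadamard_genus_zero_holds` on the
even lift of `f` — and on `StarkHadamardZeros.lean`). That theorem states the SAME printed result
typed with the entire `ζ₁_M(s) = (s − 1)ζ_M(s)` (`dedekindZeta₁`), Stark's box
`starkBox |d_M|` written with `Real.log ((discr M).natAbs : ℝ)`, and simplicity as
`analyticOrderAt ζ₁_M ρ = 1`. This file is the translation between the two typings, and nothing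
more:

* `deriv_dedekindZetaCont_ne_zero_of_analyticOrderAt_eq_one` — for `s ≠ 1`,
  `ord_s ζ₁_M = 1 ⟹ ζ_M'(s) ≠ 0` (`ζ₁_M = (z − s)·g` near `s` with `g(s) ≠ 0`, so
  `ζ_M = (z − s)·g/(z − 1)` near `s` and `ζ_M'(s) = g(s)/(s − 1)`);
* `Stark1974_dedekindZeta_atMostOneZero_holds` — a zero `s ≠ 1` of `dedekindZetaCont M` in the
  region is a zero of `ζ₁_M` in `starkBox ((discr M).natAbs)` (`(natAbs d : ℝ) = |(d : ℝ)|`), so the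
  subsingleton, reality and simplicity statements transfer.

## References

* M. R. Murty, V. K. Murty, *Non-vanishing of L-functions and Applications*, Progress in Math.
  157, Birkhäuser 1997, Ch. 2 §6, Prop. 6.1 and its proof. [MurtyMurty1997]
* H. M. Stark, *Some effective cases of the Brauer–Siegel theorem*, Invent. Math. 23 (1974)
  135–152, Lemma 3. [Stark1974]
-/

noncomputable section

open Complex Filter Topology Set NumberField

namespace Literature.NumberTheory.LFunctions.NumberField

/-- **From `ord_s ζ₁_K = 1` to `ζ_K'(s) ≠ 0`** (`s ≠ 1`): if the entire `ζ₁_K = (s − 1)ζ_K` has a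
simple zero at `s ≠ 1`, then `deriv (dedekindZetaCont K) s ≠ 0`. Locally `ζ₁_K = (z − s)·g(z)` with
`g` analytic and `g(s) ≠ 0`; off the pole `ζ_K(z) = (z − s)·g(z)/(z − 1)`, whose derivative at `s`
is `g(s)/(s − 1) ≠ 0`. [folklore] -/
theorem deriv_dedekindZetaCont_ne_zero_of_analyticOrderAt_eq_one {K : Type*} [Field K]
    [NumberField K] {s : ℂ} (hs : s ≠ 1) (hord : analyticOrderAt (dedekindZeta₁ K) s = 1) :
    deriv (dedekindZetaCont K) s ≠ 0 := by
  have han : AnalyticAt ℂ (dedekindZeta₁ K) s := analyticOnNhd_dedekindZeta₁ K univ s (mem_univ _)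
  obtain ⟨g, hg, hg0, hfg⟩ := (han.analyticOrderAt_eq_natCast (n := 1)).mp (by exact_mod_cast hord)
  have hev : dedekindZetaCont K =ᶠ[𝓝 s] fun z ↦ (z - s) * (g z / (z - 1)) := by
    filter_upwards [hfg, isOpen_compl_singleton.mem_nhds hs] with z hz hz1
    have hz1' : z ≠ 1 := hz1
    have h1 : dedekindZeta₁ K z = (z - 1) * dedekindZetaCont K z := dedekindZeta₁_apply_of_ne_one hz1'
    rw [pow_one, smul_eq_mul] at hz
    have hne : z - 1 ≠ 0 := sub_ne_zero.2 hz1'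
    field_simp
    linear_combination -h1 + hz
  rw [hev.deriv_eq]
  have hq : DifferentiableAt ℂ (fun z ↦ g z / (z - 1)) s :=
    hg.differentiableAt.div (differentiableAt_id.sub_const 1) (sub_ne_zero.2 hs)
  rw [deriv_fun_mul (c := fun z : ℂ ↦ z - s) (d := fun z ↦ g z / (z - 1)) (differentiableAt_id.sub_const s) hq,
    deriv_sub_const, deriv_id'', sub_self, zero_mul, add_zero, one_mul]
  exact div_ne_zero hg0 (sub_ne_zero.2 hs)

/-- **Stark's lemma** (Stark 1974, Lemma 3; Murty–Murty 1997, Ch. 2, Prop. 6.1, second assertion,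
with the printed proof's "real and simple"): discharge of the named fact
`Stark1974_dedekindZeta_atMostOneZero`, by translation from the tree's
`Stark1974_atMostOneZero_holds` (same printed statement typed with `ζ₁_M` and `starkBox`): a zero
`s ≠ 1` of `ζ_M` with `σ ≥ 1 − 1/(4 log|d_M|)`, `|t| ≤ 1/(4 log|d_M|)` is a zero of `ζ₁_M` in
`starkBox ((discr M).natAbs)` (`log ((discr M).natAbs : ℝ) = log |(discr M : ℝ)|`); "at most one"
and "real" transfer verbatim and "simple" (`ord = 1`) gives `ζ_M'(s) ≠ 0` by
`deriv_dedekindZetaCont_ne_zero_of_analyticOrderAt_eq_one`. [cite: MurtyMurty1997, Ch. 2 Prop. 6.1] -/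
theorem Stark1974_dedekindZeta_atMostOneZero_holds : Stark1974_dedekindZeta_atMostOneZero := by
  intro M _ _ hM
  have hlog : Real.log |(NumberField.discr M : ℝ)| = Real.log ((NumberField.discr M).natAbs : ℝ) := by
    rw [Nat.cast_natAbs, Int.cast_abs]
  intro Z
  obtain ⟨hsub, hsimple⟩ := Stark1974_atMostOneZero_holds M hM
  have hmem : ∀ s ∈ Z, dedekindZeta₁ M s = 0 ∧ s ∈ starkBox ((NumberField.discr M).natAbs : ℝ) := by
    intro s hs
    obtain ⟨h1, h2, h3, hz⟩ := hs
    refine ⟨by rw [dedekindZeta₁_apply_of_ne_one h1, hz, mul_zero], ?_⟩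
    rw [mem_starkBox_iff, ← hlog]
    exact ⟨h2, h3⟩
  refine ⟨fun s₁ hs₁ s₂ hs₂ ↦ hsub (hmem s₁ hs₁) (hmem s₂ hs₂), fun s hs ↦ ?_⟩
  obtain ⟨hz₁, hbox⟩ := hmem s hs
  obtain ⟨him, hord⟩ := hsimple s hz₁ hbox
  exact ⟨him, deriv_dedekindZetaCont_ne_zero_of_analyticOrderAt_eq_one hs.1 hord⟩

end Literature.NumberTheory.LFunctions.NumberField
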